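import Summits.ResolutionOfSingularities.ResolutionOfSingularities.Theorems.FrobeniusLadderFInjectiveMacaulayficationS2ModificationGlobal
import Summits.ResolutionOfSingularities.ResolutionOfSingularities.Theorems.FrobeniusLadderFInjectiveMacaulayficationS2ModificationCharts
import Summits.ResolutionOfSingularities.ResolutionOfSingularities.Theorems.FrobeniusLadderFInjectiveMacaulayficationFCUnguardedRungs
import HarnessLib

/-!
# `S2Modification` HOLDS — the S₂-modification of an integral surface along a closed set, assembled (file L4e of the discharge)
# (crux `FInjectiveMacaulayfication` stmt-ResolutionOfSingularities-15315, chain w45a, hole #3γ/FC″, rung r2 input S-S2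
# `FCForallExistsDimLe2.S2Modification`; res-L1-w45a-plan-1 R13.46 / R15.16; seat res-L1-w45a-stub-2; ring-level files L1/L2 (this seat),
# L3a–c (res-L1-w45a-stub-3), L4a/L4b/L4c/L4d/L5 (this seat); construction memo res-L1-w45a-stub-7 `D/res-D-pv-019/S2MOD-MEMO.md`)

[OURS · L1 W4.5a] Support file (`--supports stmt-ResolutionOfSingularities-15315 --as helper`); NOT a statement of any manuscript; no named
fact; no definitions; AI-written (AI review is weaker than expert review).

THE THEOREM `s2Modification_holds : FCForallExistsDimLe2.S2Modification`: for `X₂` integral, of finite type over a field `k`, of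
dimension `≤ 2`, and `F ⊆ X₂` closed, there is a finite surjective `g : X₃ → X₂` with `X₃` integral Noetherian, `g` a stalk isomorphism
off `F`, and with stalks over `F` Cohen–Macaulay and — when of dimension `≤ 1` — integrally closed. (The hypothesis «`X₂` is
Cohen–Macaulay off `F`» of the typed statement is not needed.)

CONSTRUCTION. `U₀ := X₂ ∖ F`. If `U₀ ≠ ∅`: `X₃ := U₀.ι.normalization` (Mathlib's relative normalisation of `X₂` in the open `U₀`),
`g := U₀.ι.fromNormalization`; integrality, surjectivity, Noetherianity and the stalk isomorphisms over `U₀` are file L4c (`…S2ModificationGlobal`);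
finiteness is affine-local (`NormalizationOfVarieties.isFinite_fromNormalization_of_finite`) from the chart identification
`Γ(X₃, g⁻¹V) ≅ integralClosure Γ(X₂, V) Γ(U₀, U₀ ∩ V) ≅ s2Mod` (L4d `…S2ModificationCharts`, L4a, L4b) and E. Noether (L5); the clauses over `F`
are stub-3's `S2ModificationAffineClauses.clauses_atPrime_of_finiteType` transported to the stalk `𝒪_{X₃,x₃} ≅ (chart ring)_𝔓`
(`IsAffineOpen.isLocalization_stalk`). If `U₀ = ∅` (`F = X₂`): `X₃ :=` the normalisation of `X₂` (tree `NormalizationOfVarieties.normalization`,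
the relative normalisation in `Spec K(X₂)`), whose chart rings are `integralClosure Γ(X₂, V) K(X₂) = s2Mod … ∅`.

[folklore] [cite: EGAIV2, 5.10.16–17]
-/

-- single-problem summit: the doubled namespace component is forced
set_option linter.dupNamespace false

noncomputable section

namespace Summit.ResolutionOfSingularities.ResolutionOfSingularities.Theorems.FInjectiveMacaulayfication.S2ModificationHolds

open Summit.ResolutionOfSingularities.ResolutionOfSingularities.Theorems.FInjectiveMacaulayfication
open S2ModificationAffine S2ModificationAffineSections S2ModificationSections S2ModificationAffineSpec S2ModificationAffineClauses
open S2ModificationGlobal S2ModificationCharts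
open CategoryTheory CategoryTheory.Limits AlgebraicGeometry TopologicalSpace Opposite
open Literature.AlgebraicGeometry.Resolution

/-! ## §1 Transport of the clauses along a ring isomorphism and to a stalk -/

/-- The two clauses for `Localization.AtPrime` transport along a RING isomorphism `e : C ≃+* D` from the prime `Q.map e` of `D` to the prime
`Q` of `C`. [folklore] -/
theorem clauses_of_ringEquiv {C D : Type} [CommRing C] [CommRing D] (e : C ≃+* D) (Q : Ideal C) [Q.IsPrime]
    (h : haveI : (Q.map e).IsPrime := Ideal.map_isPrime_of_equiv e
      NonFullLocusClosed.CMClause (Localization.AtPrime (Q.map e)) ∧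
        (ringKrullDim (Localization.AtPrime (Q.map e)) ≤ 1 → IsIntegrallyClosed (Localization.AtPrime (Q.map e)))) :
    NonFullLocusClosed.CMClause (Localization.AtPrime Q) ∧
      (ringKrullDim (Localization.AtPrime Q) ≤ 1 → IsIntegrallyClosed (Localization.AtPrime Q)) := by
  haveI : (Q.map e).IsPrime := Ideal.map_isPrime_of_equiv e
  let eLoc : Localization.AtPrime Q ≃+* Localization.AtPrime (Q.map e) :=
    IsLocalization.ringEquivOfRingEquiv (M := Q.primeCompl) (T := (Q.map e).primeCompl)
      (Localization.AtPrime Q) (Localization.AtPrime (Q.map e)) e (map_primeCompl_eq e Q)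
  obtain ⟨hCM, hIC⟩ := h
  refine ⟨FiLocusOpenOfAffine.cmClause_of_ringEquiv eLoc.symm hCM, fun h1 => ?_⟩
  haveI : IsIntegrallyClosed (Localization.AtPrime (Q.map e)) := hIC (by rwa [← ringKrullDim_eq_of_ringEquiv eLoc])
  exact IsIntegrallyClosed.of_equiv eLoc.symm

/-- Membership of a section in the prime `primeIdealOf x` of an affine open means vanishing at `x`. [folklore] -/
theorem mem_primeIdealOf_asIdeal_iff {X : Scheme.{0}} {U : X.Opens} (hU : IsAffineOpen U) (x : U) (f : Γ(X, U)) :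
    f ∈ (hU.primeIdealOf x).asIdeal ↔ (x : X) ∉ X.basicOpen f := by
  letI := X.presheaf.algebra_section_stalk x
  haveI := hU.isLocalization_stalk x
  rw [X.mem_basicOpen f x.1 x.2]
  change _ ↔ ¬ IsUnit (algebraMap Γ(X, U) (X.presheaf.stalk (x : X)) f)
  rw [IsLocalization.AtPrime.isUnit_to_map_iff (X.presheaf.stalk (x : X)) (hU.primeIdealOf x).asIdeal f]
  exact not_not.symm

/-- **The clauses over `F` at a stalk of a relative normalisation, from a chart identification.** `φ : T ⟶ X` qcqs with `X` integral,
`V ⊆ X` a non-empty affine open whose sections are of finite type over a field `k` and of dimension `≤ 2`, `s ⊆ Γ(X, V)` non-zero finite,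
and an identification of the chart ring `integralClosure Γ(X, V) Γ(T, φ ⁻¹ᵁ V)` of `φ.normalization` over `V` with `s2Mod Γ(X, V) K(X) s hs`
over `Γ(X, V)`: then at every point `x` of `φ.normalization` over `V` off all the `X.basicOpen f`, `f ∈ s`, the stalk satisfies the
Cohen–Macaulay clause and is integrally closed when of dimension `≤ 1` (stub-3's `clauses_atPrime_of_finiteType`, transported along
the chart identification, `Scheme.Hom.normalizationObjIso`, and `IsAffineOpen.isLocalization_stalk`). [folklore] [cite: EGAIV2, 5.10.16–17] -/
theorem clauses_stalk_of_chart {T X : Scheme.{0}} [IsIntegral X] (φ : T ⟶ X) [QuasiCompact φ] [QuasiSeparated φ]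
    {V : X.Opens} (hV : IsAffineOpen V) [Nonempty V] (k : Type) [Field k] [Algebra k Γ(X, V)] [Algebra.FiniteType k Γ(X, V)]
    [Algebra k X.functionField] [IsScalarTower k Γ(X, V) X.functionField] (hdim : ringKrullDim Γ(X, V) ≤ 2)
    (s : Finset Γ(X, V)) (hs : ∀ f ∈ s, f ≠ 0)
    (he : letI := (φ.app V).hom.toAlgebra
      haveI := functionField_isFractionRing_of_isAffineOpen X V hV
      Nonempty (integralClosure Γ(X, V) Γ(T, φ ⁻¹ᵁ V) ≃ₐ[Γ(X, V)] s2Mod Γ(X, V) X.functionField s hs))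
    (x : ↥φ.normalization) (hx : φ.fromNormalization.base x ∈ V) (hxs : ∀ f ∈ s, φ.fromNormalization.base x ∉ X.basicOpen f) :
    NonFullLocusClosed.CMClause (φ.normalization.presheaf.stalk x) ∧
      (ringKrullDim (φ.normalization.presheaf.stalk x) ≤ 1 → IsIntegrallyClosed (φ.normalization.presheaf.stalk x)) := by
  letI := (φ.app V).hom.toAlgebra
  haveI := functionField_isFractionRing_of_isAffineOpen X V hV
  obtain ⟨e⟩ := he
  set g := φ.fromNormalization with hg
  -- the affine open `g⁻¹ V` of the normalisation and the stalk at `x` as a localisation of its sections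
  have hV' : IsAffineOpen (g ⁻¹ᵁ V) := hV.preimage g
  letI := φ.normalization.presheaf.algebra_section_stalk (⟨x, hx⟩ : ↥(g ⁻¹ᵁ V))
  haveI := hV'.isLocalization_stalk ⟨x, hx⟩
  set P := (hV'.primeIdealOf ⟨x, hx⟩).asIdeal with hP
  -- `Γ(X₃, g⁻¹ V) ≅ integralClosure Γ(X, V) Γ(T, φ⁻¹ V)` (Mathlib) and the prime `Q` of the chart ring under `x`
  let e₂ : Γ(φ.normalization, g ⁻¹ᵁ V) ≃+* integralClosure Γ(X, V) Γ(T, φ ⁻¹ᵁ V) :=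
    (φ.normalizationObjIso hV).commRingCatIsoToRingEquiv
  haveI : (P.map e₂).IsPrime := Ideal.map_isPrime_of_equiv e₂
  haveI : ((P.map e₂).map e.toRingEquiv).IsPrime := Ideal.map_isPrime_of_equiv e.toRingEquiv
  -- the generators `f ∈ s` lie in that prime: `x ∉ X₃.basicOpen (g.app V f) = g⁻¹ (X.basicOpen f)`
  have hQ : ∀ (f : Γ(X, V)), f ∈ s →
      algebraMap Γ(X, V) (s2Mod Γ(X, V) X.functionField s hs) f ∈ (P.map e₂).map e.toRingEquiv := by
    intro f hf
    have h1 : g.app V f ∈ P := by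
      rw [hP, mem_primeIdealOf_asIdeal_iff hV' ⟨x, hx⟩ (g.app V f), ← Scheme.preimage_basicOpen]
      exact hxs f hf
    have h2 : e₂ (g.app V f) = algebraMap Γ(X, V) (integralClosure Γ(X, V) Γ(T, φ ⁻¹ᵁ V)) f := by
      have := Scheme.Hom.fromNormalization_app φ hV
      change ((φ.fromNormalization.app V) ≫ (φ.normalizationObjIso hV).hom) f = _
      rw [this, Category.assoc, Iso.inv_hom_id, Category.comp_id]
      rfl
    have h3 : e.toRingEquiv (algebraMap Γ(X, V) (integralClosure Γ(X, V) Γ(T, φ ⁻¹ᵁ V)) f) =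
        algebraMap Γ(X, V) (s2Mod Γ(X, V) X.functionField s hs) f := e.commutes f
    rw [← h3, ← h2]
    exact Ideal.mem_map_of_mem e.toRingEquiv (Ideal.mem_map_of_mem e₂ h1)
  -- stub-3's clauses at that prime of `s2Mod`, transported back along `e`, `e₂`, and to the stalk
  have hs2 := clauses_atPrime_of_finiteType Γ(X, V) X.functionField s hs ((P.map e₂).map e.toRingEquiv) k hdim hQ
  have hC := clauses_of_ringEquiv e.toRingEquiv (P.map e₂) hs2
  have hP' := clauses_of_ringEquiv e₂ P hC
  -- `Localization.AtPrime P ≅ 𝒪_{X₃, x}`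
  let e₃ : Localization.AtPrime P ≃ₐ[Γ(φ.normalization, g ⁻¹ᵁ V)] φ.normalization.presheaf.stalk x :=
    IsLocalization.algEquiv P.primeCompl _ _
  obtain ⟨hCM, hIC⟩ := hP'
  refine ⟨FiLocusOpenOfAffine.cmClause_of_ringEquiv e₃.toRingEquiv hCM, fun h1 => ?_⟩
  haveI : IsIntegrallyClosed (Localization.AtPrime P) := hIC (by rwa [ringKrullDim_eq_of_ringEquiv e₃.toRingEquiv])
  exact IsIntegrallyClosed.of_equiv e₃.toRingEquiv

/-! ## §2 Sections of finite type over the base field, and the generators of `F ∩ V` on an affine open `V` -/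

/-- For `X → Spec k` locally of finite type and an affine open `V`, `Γ(X, V)` is of finite type over `k` (through `f.appLE ⊤ V`), and
`K(X)` is a `k`-algebra compatibly. Packaged as an existence statement to be opened with `obtain`. [folklore] -/
theorem exists_finiteType_algebra {X : Scheme.{0}} [IsIntegral X] {k : Type} [Field k] (f : X ⟶ Spec (.of k))
    [LocallyOfFiniteType f] {V : X.Opens} (hV : IsAffineOpen V) [Nonempty V] :
    ∃ (_ : Algebra k Γ(X, V)) (_ : Algebra k X.functionField),
      Algebra.FiniteType k Γ(X, V) ∧ IsScalarTower k Γ(X, V) X.functionField := by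
  let φ : k →+* Γ(X, V) := (f.appLE ⊤ V le_top).hom.comp (Scheme.ΓSpecIso (.of k)).inv.hom
  have hφ : φ.FiniteType := by
    refine RingHom.FiniteType.comp ?_ (RingHom.FiniteType.of_surjective _
      (Scheme.ΓSpecIso (.of k)).symm.commRingCatIsoToRingEquiv.surjective)
    exact HasRingHomProperty.appLE @LocallyOfFiniteType f ‹_› ⟨⊤, isAffineOpen_top _⟩ ⟨V, hV⟩ le_top
  letI : Algebra k Γ(X, V) := φ.toAlgebra
  letI : Algebra k X.functionField := ((X.germToFunctionField V).hom.comp φ).toAlgebra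
  exact ⟨inferInstance, inferInstance, hφ, IsScalarTower.of_algebraMap_eq fun _ => rfl⟩

/-- **On an affine open `V`, a closed set `F` is cut out by finitely many non-zero sections**, and the complement `U₀ = X ∖ F` meets `V` in
the union of their basic opens: `F ∩ V = zeroLocus s ∩ V`, `U₀ ∩ V = ⋃_{f ∈ s} X.basicOpen f` (`X` integral and locally Noetherian; `s`
non-empty as soon as `U₀` and `V` are). [folklore] -/
theorem exists_finset_chart {X : Scheme.{0}} [IsIntegral X] [IsLocallyNoetherian X] (F : Set X) (hF : IsClosed F)
    {V : X.Opens} (hV : IsAffineOpen V) [Nonempty V] (hU₀ : Nonempty (⟨Fᶜ, hF.isOpen_compl⟩ : X.Opens)) :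
    ∃ s : Finset Γ(X, V), (∀ f ∈ s, f ≠ 0) ∧ s.Nonempty ∧
      (Scheme.Opens.ι ⟨Fᶜ, hF.isOpen_compl⟩) ''ᵁ ((Scheme.Opens.ι ⟨Fᶜ, hF.isOpen_compl⟩) ⁻¹ᵁ V) =
        ⨆ f : s, X.basicOpen (f : Γ(X, V)) ∧
      ∀ x : X, x ∈ V → (x ∈ F ↔ ∀ f ∈ s, x ∉ X.basicOpen f) := by
  classical
  set U₀ : X.Opens := ⟨Fᶜ, hF.isOpen_compl⟩ with hU₀def
  haveI : IsNoetherianRing Γ(X, V) := IsLocallyNoetherian.component_noetherian ⟨V, hV⟩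
  -- `F ∩ V` is the zero locus of an ideal `I` of `Γ(X, V)`
  have hZ : IsClosed (hV.fromSpec.base ⁻¹' F) := hF.preimage hV.fromSpec.base.hom.continuous
  obtain ⟨I, hI⟩ := (PrimeSpectrum.isClosed_iff_zeroLocus_ideal _).mp hZ
  have hFV : F ∩ (V : Set X) = X.zeroLocus (I : Set Γ(X, V)) ∩ V := by
    rw [← hV.fromSpec_image_zeroLocus, ← hI, Set.image_preimage_eq_inter_range, IsAffineOpen.range_fromSpec]
  -- generators, with the zeros removed
  obtain ⟨s₀, hs₀⟩ := (inferInstance : IsNoetherian Γ(X, V) Γ(X, V)).noetherian I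
  let s : Finset Γ(X, V) := s₀.filter (· ≠ 0)
  have hmem : ∀ x : X, x ∈ X.zeroLocus (I : Set Γ(X, V)) ↔ ∀ f ∈ s, x ∉ X.basicOpen f := by
    intro x
    rw [← hs₀, Ideal.submodule_span_eq, Scheme.zeroLocus_span, Scheme.mem_zeroLocus_iff]
    constructor
    · intro h f hf
      exact h f (Finset.mem_filter.mp hf).1
    · intro h f hf
      by_cases hf0 : f = 0
      · subst hf0
        rw [Scheme.basicOpen_zero]
        exact fun h => h
      · exact h f (Finset.mem_filter.mpr ⟨hf, hf0⟩)
  have hchar : ∀ x : X, x ∈ V → (x ∈ F ↔ ∀ f ∈ s, x ∉ X.basicOpen f) := by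
    intro x hxV
    rw [← hmem]
    constructor
    · intro hxF
      exact ((Set.ext_iff.mp hFV x).mp ⟨hxF, hxV⟩).1
    · intro hxZ
      exact ((Set.ext_iff.mp hFV x).mpr ⟨hxZ, hxV⟩).1
  -- `U₀ ∩ V = ⋃ X.basicOpen f`
  have hopens : U₀.ι ''ᵁ (U₀.ι ⁻¹ᵁ V) = ⨆ f : s, X.basicOpen (f : Γ(X, V)) := by
    rw [Scheme.Hom.image_preimage_eq_opensRange_inf, Scheme.Opens.opensRange_ι]
    ext x
    simp only [Opens.coe_inf, Set.mem_inter_iff, SetLike.mem_coe, Opens.coe_iSup, Set.mem_iUnion]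
    constructor
    · rintro ⟨hxU, hxV⟩
      have hxF : x ∉ F := hxU
      by_contra hcon
      exact hxF ((hchar x hxV).mpr fun f hf hxf => hcon ⟨⟨f, hf⟩, hxf⟩)
    · rintro ⟨⟨f, hf⟩, hxf⟩
      have hxV : x ∈ V := X.basicOpen_le f hxf
      refine ⟨?_, hxV⟩
      change x ∈ Fᶜ
      intro hxF
      exact ((hchar x hxV).mp hxF) f hf hxf
  -- `s` is non-empty: `U₀ ∩ V ≠ ∅`
  have hsne : s.Nonempty := by
    by_contra hcon
    have hbot : U₀.ι ''ᵁ (U₀.ι ⁻¹ᵁ V) = ⊥ := by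
      rw [hopens]
      refine le_bot_iff.mp (iSup_le fun f => ?_)
      exact absurd ⟨f.1, f.2⟩ hcon
    have hne : ((U₀ ⊓ V : X.Opens) : Set X).Nonempty := by
      obtain ⟨u⟩ := hU₀
      obtain ⟨v⟩ := ‹Nonempty V›
      exact nonempty_preirreducible_inter U₀.isOpen V.isOpen ⟨_, u.2⟩ ⟨_, v.2⟩
    rw [Scheme.Hom.image_preimage_eq_opensRange_inf, Scheme.Opens.opensRange_ι] at hbot
    rw [hbot] at hne
    exact Set.not_nonempty_empty hne
  exact ⟨s, fun f hf => (Finset.mem_filter.mp hf).2, hsne, hopens, hchar⟩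

/-! ## §3 The theorem -/

/-- **`S2Modification` holds**: the S₂-modification of an integral scheme of finite type over a field of dimension `≤ 2` along any closed
set `F` — finite, surjective, integral Noetherian source, a stalk isomorphism off `F`, and with Cohen–Macaulay stalks over `F` that are
integrally closed when of dimension `≤ 1`. Construction: Mathlib's relative normalisation of `X₂` in `X₂ ∖ F` (resp. in `Spec K(X₂)`
when `F = X₂`). [folklore] [cite: EGAIV2, 5.10.16–17] -/
theorem s2Modification_holds : FCForallExistsDimLe2.S2Modification := by
  intro k _ X₂ f₂ hft hqc hint hdim F hF _hCM
  haveI := hft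
  haveI := hqc
  haveI : IsLocallyNoetherian X₂ := LocallyOfFiniteType.isLocallyNoetherian f₂
  haveI : CompactSpace X₂ := QuasiCompact.compactSpace_of_compactSpace f₂
  haveI : IsNoetherian X₂ := {}
  set U₀ : X₂.Opens := ⟨Fᶜ, hF.isOpen_compl⟩ with hU₀def
  by_cases hU₀ : Nonempty U₀
  · /- MAIN CASE `F ≠ X₂`: the relative normalisation of `X₂` in `U₀ = X₂ ∖ F` -/
    set g := U₀.ι.fromNormalization with hg
    -- finiteness, affine-locally over the non-empty affine opens
    have hfin : IsFinite g := by
      refine isFinite_fromNormalization_of_finite U₀.ι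
        (fun V : {V : X₂.affineOpens // Nonempty (V : X₂.Opens)} => V.1) (iSup_nonempty_affineOpens_eq_top X₂) fun V => ?_
      haveI : Nonempty (V.1 : X₂.Opens) := V.2
      obtain ⟨s, hs, hne, hVU, -⟩ := exists_finset_chart F hF V.1.2 hU₀
      obtain ⟨_, _, hFT, _⟩ := exists_finiteType_algebra f₂ V.1.2
      exact module_finite_integralClosure_chart U₀ V.1.2 s hs hne hVU k
    haveI := hfin
    refine ⟨U₀.ι.normalization, g, inferInstance, isNoetherian_normalization U₀, hfin, surjective_fromNormalization U₀,
      fun x₃ hx₃ => isIso_stalkMap_fromNormalization U₀ x₃ hx₃, fun x₃ hx₃ => ?_⟩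
    -- the clauses over `F`: on an affine chart around `g x₃`
    obtain ⟨_, ⟨V, hV, rfl⟩, hxV, -⟩ := X₂.isBasis_affineOpens.exists_subset_of_mem_open (Set.mem_univ (g.base x₃)) isOpen_univ
    haveI : Nonempty V := ⟨⟨_, hxV⟩⟩
    obtain ⟨s, hs, hne, hVU, hchar⟩ := exists_finset_chart F hF hV hU₀
    obtain ⟨_, _, hFT, hST⟩ := exists_finiteType_algebra f₂ hV
    haveI := hFT
    haveI := hST
    exact clauses_stalk_of_chart U₀.ι hV k (ringKrullDim_le_of_isAffineOpen X₂ hV hdim) s hs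
      (exists_algEquiv_chart U₀ hV s hs hne hVU).nonempty x₃ hxV ((hchar _ hxV).mp hx₃)
  · /- DEGENERATE CASE `F = X₂`: the normalisation of `X₂` -/
    have hFuniv : ∀ x : X₂, x ∈ F := fun x => by
      by_contra hx
      exact hU₀ ⟨⟨x, hx⟩⟩
    set g := normalizationι X₂ with hg
    have hfin : IsFinite g := isFinite_normalizationι X₂ NoetherFiniteIntegralClosure_holds f₂
    haveI := hfin
    haveI : IsLocallyNoetherian (normalization X₂) := LocallyOfFiniteType.isLocallyNoetherian g
    haveI : CompactSpace ↥(normalization X₂) := QuasiCompact.compactSpace_of_compactSpace g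
    haveI : IsNoetherian (normalization X₂) := {}
    haveI : Surjective g := surjective_of_isDominant_of_isClosed_range _ g.isClosedMap.isClosed_range
    refine ⟨normalization X₂, g, inferInstance, inferInstance, hfin, g.surjective, fun x₃ hx₃ => absurd (hFuniv _) hx₃,
      fun x₃ _ => ?_⟩
    obtain ⟨_, ⟨V, hV, rfl⟩, hxV, -⟩ := X₂.isBasis_affineOpens.exists_subset_of_mem_open (Set.mem_univ (g.base x₃)) isOpen_univ
    haveI : Nonempty V := ⟨⟨_, hxV⟩⟩
    obtain ⟨_, _, hFT, hST⟩ := exists_finiteType_algebra f₂ hV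
    haveI := hFT
    haveI := hST
    haveI := functionField_isFractionRing_of_isAffineOpen X₂ V hV
    -- chart identification with `s = ∅`: `integralClosure Γ(X₂, V) Γ(Spec K, ξ⁻¹V) ≃ₐ s2Mod … ∅` through `K(X₂) ≃ₐ Γ(Spec K, ξ⁻¹V)`
    letI := ((fromSpecFunctionField X₂).app V).hom.toAlgebra
    let ι : Γ(Spec X₂.functionField, fromSpecFunctionField X₂ ⁻¹ᵁ V) →ₐ[Γ(X₂, V)] X₂.functionField :=
      (functionFieldAlgEquivSections (X := X₂) V).symm.toAlgHom
    have hinj : Function.Injective ι := (functionFieldAlgEquivSections (X := X₂) V).symm.injective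
    have hrange : ∀ z : X₂.functionField, z ∈ Set.range ι ↔
        ∀ (f : Γ(X₂, V)) (hf : f ∈ (∅ : Finset Γ(X₂, V))), z ∈ awaySub Γ(X₂, V) X₂.functionField f (by simp at hf) := by
      intro z
      constructor
      · intro _ f hf
        simp at hf
      · intro _
        exact ⟨(functionFieldAlgEquivSections (X := X₂) V) z, (functionFieldAlgEquivSections (X := X₂) V).symm_apply_apply z⟩
    obtain ⟨e, -⟩ := exists_algEquiv_integralClosure_s2Mod Γ(X₂, V) X₂.functionField ∅ (by simp) _ ι hinj hrange
    exact clauses_stalk_of_chart (fromSpecFunctionField X₂) hV k (ringKrullDim_le_of_isAffineOpen X₂ hV hdim) ∅ (by simp)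
      ⟨e⟩ x₃ hxV (by simp)

/-! ## §4 Consumers: the dimension-`≤ 2` rungs of FC′ / FC″ no longer take `S2Modification` as a hypothesis -/

/-- **FC′(dim ≤ 2) from Datta–Murayama (BY NAME) and openness of the Cohen–Macaulay locus alone**: F3's kernel
`FCForallExistsDimLe2.fcForallExistsDimLe2_of_named` with S-S2 discharged by `s2Modification_holds` and S-V by
`FiniteModificationOfBlowup.finiteModificationOfBlowupIsBlowup_holds`. [OURS assembly] [cite: DattaMurayama2024, Thm. B] -/
theorem fcForallExistsDimLe2_of_DM_CMLocusOpen
    (hDM : Literature.AlgebraicGeometry.Resolution.DattaMurayama2024_fInjectiveLocusOpen.{0})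
    (hCMo : NonFullLocusClosed.CMLocusOpen) : FCForallExistsDimLe2.FCForallExistsDimLe2 :=
  FCForallExistsDimLe2.fcForallExistsDimLe2_of_named hDM hCMo s2Modification_holds
    FiniteModificationOfBlowup.finiteModificationOfBlowupIsBlowup_holds

/-- **FC″(dim ≤ 2) from `NonFullLocusClosed` alone** (`FCUnguardedRungs.fcUnguardedDimLe2_of` with S-S2 discharged). [OURS assembly] -/
theorem fcUnguardedDimLe2_of_nonFullLocusClosed (hNF : NonFullLocusClosed.NonFullLocusClosed) : FCUnguardedRungs.FCUnguardedDimLe2 :=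
  FCUnguardedRungs.fcUnguardedDimLe2_of hNF s2Modification_holds

/-- **FC″(dim ≤ 2) from Datta–Murayama (BY NAME) and openness of the Cohen–Macaulay locus alone**
(`FCUnguardedRungs.fcUnguardedDimLe2_of_named` with S-S2 discharged). [OURS assembly] [cite: DattaMurayama2024, Thm. B] -/
theorem fcUnguardedDimLe2_of_DM_CMLocusOpen
    (hDM : Literature.AlgebraicGeometry.Resolution.DattaMurayama2024_fInjectiveLocusOpen.{0})
    (hCMo : NonFullLocusClosed.CMLocusOpen) : FCUnguardedRungs.FCUnguardedDimLe2 :=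
  FCUnguardedRungs.fcUnguardedDimLe2_of_named hDM hCMo s2Modification_holds

/-- **Door v30's `stub_fcUnguarded` reduced to dimension `≥ 4` WITHOUT the S-S2 hypothesis**: FC″ follows from Datta–Murayama, openness of
the Cohen–Macaulay locus, the three threefold facts (all BY NAME) and the dimension-`≥ 4` residual `FCUnguardedDimGe4`
(`FCUnguardedRungs.fcUnguarded_of_dimGe4_named` with `hS2 := s2Modification_holds`). [OURS assembly] [cite: DattaMurayama2024, Thm. B]
[cite: CossartPiltant2019, Thm. 1.1 (i)(ii); Prop. 4.4] [cite: StacksProject, Tag 081T] -/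
theorem fcUnguarded_of_dimGe4_named
    (hDM : Literature.AlgebraicGeometry.Resolution.DattaMurayama2024_fInjectiveLocusOpen.{0})
    (hCMo : NonFullLocusClosed.CMLocusOpen)
    (hG : CossartPiltant2019General.{0}) (h081R : Stacks081R.{0}) (hP : CossartPiltant2019Principalization.{0})
    (h4 : FCUnguardedRungs.FCUnguardedDimGe4) : GenericFibreReduction.FCUnguarded :=
  FCUnguardedRungs.fcUnguarded_of_dimGe4_named hDM hCMo s2Modification_holds hG h081R hP h4

end Summit.ResolutionOfSingularities.ResolutionOfSingularities.Theorems.FInjectiveMacaulayfication.S2ModificationHolds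

end
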